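import Literature.LinearAlgebra.Matrix.CyclotomicIntegerMatrixClasses
import Literature.NumberTheory.LFunctions.QuadraticClassNumberDvdMinusClassNumber
import HarnessLib

/-!
# `p = 23`: the elements of order `23` of `GL_{22}(ℤ)` fall into at least THREE conjugacy classes (their number is
# divisible by `3`) — Latimer–MacDuffee–Taussky for `f = Φ_{23}` with `3 ∣ h(ℚ(ζ_{23}))` (Kummer)

[topic LinearAlgebra/Matrix] Lane `lit-hodgefound` (Track 2 foundations library), seat p15 generation 39, row g39-#5 —
the first prime where the count of g39-#2 `CyclotomicIntegerMatrixClasses` (`#{χ_B = Φ_p}/GL_{p−1}(ℤ) = h(ℚ(ζ_p))`)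
exceeds one: `h(ℚ(ζ_p)) = 1` for `p ≤ 19` (the tree's cases `p ≤ 11` give ONE class, g39-#4
`CyclotomicIntegerMatrixClassesClassNumberOne`), while `h(ℚ(ζ_{23})) = 3`; the tree proves `3 ∣ h(ℚ(ζ_{23}))`
(`Literature.NumberTheory.LFunctions.QuadraticClassNumberDvdMinusClassNumber.three_dvd_classNumber_twentyThree`,
through `h(ℚ(√−23)) = 3` and Okazaki's `h(ℚ(√−p)) ∣ h⁻(ℚ(ζ_p))`).  THEOREMS ONLY (no definition, no instance, no
named fact; D-0026 net Literature debt `0`; no `sorry`).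

## Sources, VERBATIM

J. Brzeziński, *On two classical theorems in the theory of orders*, J. Number Theory 34 (1990) 21–32
[Brzezinski1990] (held `paper:doi-10-1016-0022-314x-90-90049-w`, p0001), **(0.1) THEOREM** (Latimer–MacDuffee 1933
[LatimerMacduffee1933], Taussky 1949 [Taussky1949]): «Let `Λ = M_n(ℤ)` and let `S = ℤ[θ]`, where `f(θ) = 0` for a
monic separable polynomial `f ∈ ℤ[X]` of degree `n`. Then there is a one-to-one correspondence between the
`Λ* = GL_n(ℤ)`-orbits on the (ring-)embeddings of `S` into `Λ` and the ideal classes of `S`. […] there is a bijection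
between the embeddings and the solutions to `f(X) = 0` in `Λ`.»  With `f = Φ_{23}`, `n = 22`, `S = ℤ[ζ_{23}] = 𝒪`:
the classes of elements of order `23` of `GL_{22}(ℤ)` are the `h(ℚ(ζ_{23}))` ideal classes, and
L. C. Washington, *Introduction to Cyclotomic Fields* [Washington1997], Ch. 1 («`ℤ[ζ_{23}]` is not a unique
factorization domain»; Thm. 11.1 and tables: `h(ℚ(ζ_{23})) = 3`) — here in the tree's proved form `3 ∣ h(ℚ(ζ_{23}))`.

## What is formalised

* `three_dvd_natCard_quot_conj_charpoly_cyclotomic_twentyThree`, `three_le_…`: the number of `GL_{22}(ℤ)`-classes of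
  integer `22 × 22` matrices with `χ = Φ_{23}` is divisible by `3`, hence at least `3`;
  **`exists_three_not_conj_of_charpoly_eq_cyclotomic_twentyThree`**: three such matrices, pairwise NOT conjugate by
  any element of `GL_{22}(ℤ)`.
* `three_dvd_natCard_quot_isConj_orderOf_eq_twentyThree`, `three_le_…` and
  **`exists_three_not_isConj_orderOf_eq_twentyThree`**: in the group `GL_{22}(ℤ) = (M_{22}(ℤ))ˣ` there are three
  elements of order `23` that are pairwise non-conjugate — in contrast with `GL_{p−1}(ℤ)` for `p ≤ 11`, where all
  elements of order `p` are conjugate (g39-#4).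

Not here: the exact value `3` (needs `h(ℚ(ζ_{23})) ≤ 3`, not in the tree), `p = 13, 17, 19` (class number one, not yet
in the tree), larger `p`.

## References
* [Brzezinski1990] J. Brzeziński, J. Number Theory 34 (1990) 21–32, (0.1) Theorem. [cite: Brzezinski1990, (0.1) Theorem, p. 21]
* [Washington1997] L. C. Washington, *Introduction to Cyclotomic Fields*, 2nd ed., GTM 83, Ch. 1 and Thm. 11.1.
* [Taussky1949] O. Taussky, Canad. J. Math. 1 (1949) 300–302, Thms. 1–4.
* [LatimerMacduffee1933] C. G. Latimer, C. C. MacDuffee, Ann. of Math. 34 (1933) 313–316.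
-/

noncomputable section

open scoped Classical nonZeroDivisors NumberField
open Polynomial Module Submodule

namespace Literature.LinearAlgebra.Matrix.CyclotomicIntegerMatrixClassesTwentyThree

open Literature.LinearAlgebra.Matrix.CyclotomicIntegerMatrixClasses
  (natCard_quot_conj_charpoly_cyclotomic natCard_quot_isConj_orderOf_eq_prime)
open Literature.NumberTheory.LFunctions.QuadraticClassNumberDvdMinusClassNumber
  (three_dvd_classNumber_cyclotomicField_twentyThree)

/-! ## §0 Plumbing: three classes ⟹ three pairwise unrelated representatives -/

/-- If a quotient `Quot r` has at least three elements, there are three representatives no two of which are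
`r`-related (related elements have equal classes). [folklore] -/
private theorem exists_three_not_rel {α : Type*} {r : α → α → Prop} (h3 : 3 ≤ Nat.card (Quot r)) :
    ∃ a b c : α, ¬ r a b ∧ ¬ r a c ∧ ¬ r b c := by
  have hne : Nat.card (Quot r) ≠ 0 := by omega
  let e : Quot r ≃ Fin (Nat.card (Quot r)) := Nat.equivFinOfCardPos hne
  let q : Fin 3 → Quot r := fun i => e.symm (Fin.castLE h3 i)
  have hq : Function.Injective q := fun i j hij => by
    have := Fin.castLE_injective h3 (e.symm.injective hij)
    exact this
  obtain ⟨a, ha⟩ := Quot.exists_rep (q 0)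
  obtain ⟨b, hb⟩ := Quot.exists_rep (q 1)
  obtain ⟨c, hc⟩ := Quot.exists_rep (q 2)
  have h01 : q 0 ≠ q 1 := fun h => absurd (hq h) (by decide)
  have h02 : q 0 ≠ q 2 := fun h => absurd (hq h) (by decide)
  have h12 : q 1 ≠ q 2 := fun h => absurd (hq h) (by decide)
  refine ⟨a, b, c, fun h => h01 ?_, fun h => h02 ?_, fun h => h12 ?_⟩
  · rw [← ha, ← hb]; exact Quot.sound h
  · rw [← ha, ← hc]; exact Quot.sound h
  · rw [← hb, ← hc]; exact Quot.sound h

/-- `3 ∣ h(ℚ(ζ_{23}))` read on `#Cl(𝒪)` of Mathlib's model, and `3 ≤ #Cl(𝒪)`. [cite: Washington1997, Thm. 11.1 (tables: `h(ℚ(ζ_23)) = 3`)] -/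
private theorem three_dvd_card_classGroup_and_le :
    3 ∣ Fintype.card (ClassGroup (𝓞 (CyclotomicField 23 ℚ))) ∧
      3 ≤ Fintype.card (ClassGroup (𝓞 (CyclotomicField 23 ℚ))) := by
  have h3 : 3 ∣ NumberField.classNumber (CyclotomicField 23 ℚ) := three_dvd_classNumber_cyclotomicField_twentyThree
  have hpos : 0 < NumberField.classNumber (CyclotomicField 23 ℚ) := NumberField.classNumber_pos _
  exact ⟨h3, Nat.le_of_dvd hpos h3⟩

/-! ## §1 Integer `22 × 22` matrices with characteristic polynomial `Φ_{23}` -/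

/-- **The number of `GL_{22}(ℤ)`-classes of integer `22 × 22` matrices with characteristic polynomial `Φ_{23}` is
divisible by `3`** (it equals `h(ℚ(ζ_{23}))`, g39-#2, and `3 ∣ h(ℚ(ζ_{23}))`). [cite: Brzezinski1990, (0.1) Theorem (with `f = Φ_23`, `n = 22`), p. 21] [cite: Washington1997, Thm. 11.1] -/
theorem three_dvd_natCard_quot_conj_charpoly_cyclotomic_twentyThree :
    3 ∣ Nat.card (Quot (fun B B' : {B : _root_.Matrix (Fin 22) (Fin 22) ℤ // B.charpoly = cyclotomic 23 ℤ} =>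
        ∃ Q : _root_.Matrix (Fin 22) (Fin 22) ℤ, IsUnit Q.det ∧ Q * B.1 = B'.1 * Q)) := by
  haveI : IsCyclotomicExtension {23} ℚ (CyclotomicField 23 ℚ) := CyclotomicField.isCyclotomicExtension 23 ℚ
  rw [natCard_quot_conj_charpoly_cyclotomic (n := 23) (CyclotomicField 23 ℚ)
    ((Nat.totient_prime (by norm_num)).trans rfl)]
  exact three_dvd_card_classGroup_and_le.1

/-- **At least three `GL_{22}(ℤ)`-classes of integer matrices with characteristic polynomial `Φ_{23}`.**
[cite: Brzezinski1990, (0.1) Theorem (with `f = Φ_23`, `n = 22`), p. 21] [cite: Washington1997, Thm. 11.1] -/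
theorem three_le_natCard_quot_conj_charpoly_cyclotomic_twentyThree :
    3 ≤ Nat.card (Quot (fun B B' : {B : _root_.Matrix (Fin 22) (Fin 22) ℤ // B.charpoly = cyclotomic 23 ℤ} =>
        ∃ Q : _root_.Matrix (Fin 22) (Fin 22) ℤ, IsUnit Q.det ∧ Q * B.1 = B'.1 * Q)) := by
  haveI : IsCyclotomicExtension {23} ℚ (CyclotomicField 23 ℚ) := CyclotomicField.isCyclotomicExtension 23 ℚ
  rw [natCard_quot_conj_charpoly_cyclotomic (n := 23) (CyclotomicField 23 ℚ)
    ((Nat.totient_prime (by norm_num)).trans rfl)]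
  exact three_dvd_card_classGroup_and_le.2

/-- **Three integer `22 × 22` matrices with characteristic polynomial `Φ_{23}`, no two of which are conjugate by an
element of `GL_{22}(ℤ)`** («`ℤ[ζ_{23}]` does not have unique factorization»: `h(ℚ(ζ_{23})) = 3 > 1`, the first such
prime). [cite: Brzezinski1990, (0.1) Theorem (with `f = Φ_23`, `n = 22`), p. 21] [cite: Washington1997, Ch. 1 and Thm. 11.1] -/
theorem exists_three_not_conj_of_charpoly_eq_cyclotomic_twentyThree :
    ∃ B₁ B₂ B₃ : _root_.Matrix (Fin 22) (Fin 22) ℤ,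
      B₁.charpoly = cyclotomic 23 ℤ ∧ B₂.charpoly = cyclotomic 23 ℤ ∧ B₃.charpoly = cyclotomic 23 ℤ ∧
      (¬ ∃ Q : _root_.Matrix (Fin 22) (Fin 22) ℤ, IsUnit Q.det ∧ Q * B₁ = B₂ * Q) ∧
      (¬ ∃ Q : _root_.Matrix (Fin 22) (Fin 22) ℤ, IsUnit Q.det ∧ Q * B₁ = B₃ * Q) ∧
      (¬ ∃ Q : _root_.Matrix (Fin 22) (Fin 22) ℤ, IsUnit Q.det ∧ Q * B₂ = B₃ * Q) := by
  obtain ⟨a, b, c, hab, hac, hbc⟩ := exists_three_not_rel three_le_natCard_quot_conj_charpoly_cyclotomic_twentyThree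
  exact ⟨a.1, b.1, c.1, a.2, b.2, c.2, hab, hac, hbc⟩

/-! ## §2 Elements of order `23` of `GL_{22}(ℤ)` -/

/-- **The number of conjugacy classes of elements of order `23` of `GL_{22}(ℤ) = (M_{22}(ℤ))ˣ` is divisible by `3`.**
[cite: Brzezinski1990, (0.1) Theorem (with `f = Φ_23`, `n = 22`: «the `Λ* = GL_n(ℤ)`-orbits … by conjugation»), p. 21] [cite: Washington1997, Thm. 11.1] -/
theorem three_dvd_natCard_quot_isConj_orderOf_eq_twentyThree :
    3 ∣ Nat.card (Quot (fun g g' : {g : (_root_.Matrix (Fin 22) (Fin 22) ℤ)ˣ // orderOf g = 23} =>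
        IsConj g.1 g'.1)) := by
  haveI : Fact (Nat.Prime 23) := ⟨by norm_num⟩
  haveI : IsCyclotomicExtension {23} ℚ (CyclotomicField 23 ℚ) := CyclotomicField.isCyclotomicExtension 23 ℚ
  rw [natCard_quot_isConj_orderOf_eq_prime (p := 23) (CyclotomicField 23 ℚ)]
  exact three_dvd_card_classGroup_and_le.1

/-- **At least three conjugacy classes of elements of order `23` in `GL_{22}(ℤ)`.** [cite: Brzezinski1990, (0.1) Theorem (with `f = Φ_23`, `n = 22`), p. 21] [cite: Washington1997, Thm. 11.1] -/
theorem three_le_natCard_quot_isConj_orderOf_eq_twentyThree :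
    3 ≤ Nat.card (Quot (fun g g' : {g : (_root_.Matrix (Fin 22) (Fin 22) ℤ)ˣ // orderOf g = 23} =>
        IsConj g.1 g'.1)) := by
  haveI : Fact (Nat.Prime 23) := ⟨by norm_num⟩
  haveI : IsCyclotomicExtension {23} ℚ (CyclotomicField 23 ℚ) := CyclotomicField.isCyclotomicExtension 23 ℚ
  rw [natCard_quot_isConj_orderOf_eq_prime (p := 23) (CyclotomicField 23 ℚ)]
  exact three_dvd_card_classGroup_and_le.2

/-- **`GL_{22}(ℤ)` contains three elements of order `23` that are pairwise NON-conjugate** — whereas for every prime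
`p ≤ 11` all elements of order `p` of `GL_{p−1}(ℤ)` are conjugate (g39-#4): `23` is the first prime with
`h(ℚ(ζ_p)) > 1`. [cite: Brzezinski1990, (0.1) Theorem (with `f = Φ_23`, `n = 22`), p. 21] [cite: Washington1997, Ch. 1 and Thm. 11.1] -/
theorem exists_three_not_isConj_orderOf_eq_twentyThree :
    ∃ g₁ g₂ g₃ : (_root_.Matrix (Fin 22) (Fin 22) ℤ)ˣ,
      orderOf g₁ = 23 ∧ orderOf g₂ = 23 ∧ orderOf g₃ = 23 ∧ ¬ IsConj g₁ g₂ ∧ ¬ IsConj g₁ g₃ ∧ ¬ IsConj g₂ g₃ := by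
  obtain ⟨a, b, c, hab, hac, hbc⟩ := exists_three_not_rel three_le_natCard_quot_isConj_orderOf_eq_twentyThree
  exact ⟨a.1, b.1, c.1, a.2, b.2, c.2, hab, hac, hbc⟩

end Literature.LinearAlgebra.Matrix.CyclotomicIntegerMatrixClassesTwentyThree
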